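import Literature.Probability.Percolation.KozmaNitzanSeparatingTriple
import HarnessLib

/-!
# One pair weight at a time: the effect of opening a pair at the port on the isolation events

Support file for crux `stmt-CriticalPhenomena-4575` (`NoHeavyLowerTail`), seat `prim-l12-p1` gen 22 (`--supports stmt-CriticalPhenomena-4575`);
memo `run/shared/lean/prim/prim-l12/FROM-prim-l12-p1-g22-CHALF-ALL-GRAPHS.md`.  First of three graph-level files proving the sextic isolation law
`(Q6)` and the face inequality `(C½)` on EVERY finite weighted graph (`…ThreePointIsoSexticSureComponent`, `…ThreePointIsoSexticAllGraphs`).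
Bond percolation `μ_w = prodBernoulli w` with arbitrary pair weights `w : Sym2 V → [0,1]` on a finite vertex type; isolation events of terminals
`a, b` and a port `c`: `a|b|c = (a↔b)ᶜ ∩ (a↔c)ᶜ ∩ (b↔c)ᶜ`, `I_c = (a↔c)ᶜ ∩ (b↔c)ᶜ`, `I_b = (a↔b)ᶜ ∩ (b↔c)ᶜ`, `I_a = (a↔b)ᶜ ∩ (a↔c)ᶜ`.

(The one-bond decomposition `μ_w(A) = (1 − w e)·μ_{w[e↦0]}(A) + (w e)·μ_{w[e↦1]}(A)` and `μ_{w[e↦1]}(A) = μ_w{ω : ω ∪ {e} ∈ A}` are the tree's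
`Literature…prodBernoulli_real_oneBond`, `prodBernoulli_real_update_one_eq`; they are used in `…ThreePointIsoSexticAllGraphs`.)
* `setOf_insert_mem_sep/isoA/isoB/isoC` — opening the pair `e = cx` acts on the four events by `a|b|c ↦ a|b|c ∩ (a↮x) ∩ (b↮x)`,
  `I_a ↦ I_a ∩ (a↮x)`, `I_b ↦ I_b ∩ (b↮x)`, `I_c ↦ I_c ∩ (a↮x) ∩ (b↮x)` (from the tree's one-extra-edge lemma `KNSep.reachable_insert_iff`; valid for
  ALL `a, b, c, x`), `sep_inter_compl_inter_eq` — on `a|b|c` the events `a↔x`, `b↔x` are disjoint, and the bookkeeping identities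
  `setOf_alone_eq_isoA/B`, `setOf_pairwiseSep_eq` matching the event shapes of `Literature…lonerAttachment_alone_le_allSep` (BHK 2006 Thm 1.3).
No definitions, no sorries, standard axioms.
-/
namespace Summit.CriticalPhenomena.PercolationContinuityZ3.Theorems.ThreePointIsoSexticOneBond

open MeasureTheory Set
open Literature.Probability.Percolation Literature.Probability.LatticeModels
open scoped Classical


/-! ## Opening the pair `cx`: the four isolation events -/

section Events

variable {V : Type*}

/-- Opening `cx`: `a|b|c` becomes `a|b|c ∩ (a ↮ x) ∩ (b ↮ x)`. [this work] -/
theorem setOf_insert_mem_sep (a b c x : V) :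
    {ω : BondConfig V | insert s(c, x) ω ∈ ((openConn a b)ᶜ ∩ (openConn a c)ᶜ ∩ (openConn b c)ᶜ : Set (BondConfig V))} =
      (openConn a b)ᶜ ∩ (openConn a c)ᶜ ∩ (openConn b c)ᶜ ∩ (openConn a x)ᶜ ∩ (openConn b x)ᶜ := by
  ext ω
  have hab := KNSep.reachable_insert_iff ω c x a b
  have hac := KNSep.reachable_insert_iff ω c x a c
  have hbc := KNSep.reachable_insert_iff ω c x b c
  have hcc : (openGraph ω).Reachable c c := SimpleGraph.Reachable.refl c
  simp only [mem_setOf_eq, mem_inter_iff, mem_compl_iff, openConn, hab, hac, hbc]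
  constructor
  · rintro ⟨⟨h1, h2⟩, h3⟩
    exact ⟨⟨⟨⟨fun h => h1 (Or.inl h), fun h => h2 (Or.inl h)⟩, fun h => h3 (Or.inl h)⟩,
      fun h => h2 (Or.inr (Or.inr ⟨h, hcc⟩))⟩, fun h => h3 (Or.inr (Or.inr ⟨h, hcc⟩))⟩
  · rintro ⟨⟨⟨⟨nab, nac⟩, nbc⟩, nax⟩, nbx⟩
    refine ⟨⟨?_, ?_⟩, ?_⟩
    · rintro (h | ⟨h, -⟩ | ⟨h, -⟩)
      · exact nab h
      · exact nac h
      · exact nax h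
    · rintro (h | ⟨h, -⟩ | ⟨h, -⟩)
      · exact nac h
      · exact nac h
      · exact nax h
    · rintro (h | ⟨h, -⟩ | ⟨h, -⟩)
      · exact nbc h
      · exact nbc h
      · exact nbx h

/-- Opening `cx`: `I_a = (a↮b) ∩ (a↮c)` becomes `I_a ∩ (a ↮ x)`. [this work] -/
theorem setOf_insert_mem_isoA (a b c x : V) :
    {ω : BondConfig V | insert s(c, x) ω ∈ ((openConn a b)ᶜ ∩ (openConn a c)ᶜ : Set (BondConfig V))} =
      (openConn a b)ᶜ ∩ (openConn a c)ᶜ ∩ (openConn a x)ᶜ := by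
  ext ω
  have hab := KNSep.reachable_insert_iff ω c x a b
  have hac := KNSep.reachable_insert_iff ω c x a c
  have hcc : (openGraph ω).Reachable c c := SimpleGraph.Reachable.refl c
  simp only [mem_setOf_eq, mem_inter_iff, mem_compl_iff, openConn, hab, hac]
  constructor
  · rintro ⟨h1, h2⟩
    exact ⟨⟨fun h => h1 (Or.inl h), fun h => h2 (Or.inl h)⟩, fun h => h2 (Or.inr (Or.inr ⟨h, hcc⟩))⟩
  · rintro ⟨⟨nab, nac⟩, nax⟩
    refine ⟨?_, ?_⟩
    · rintro (h | ⟨h, -⟩ | ⟨h, -⟩)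
      · exact nab h
      · exact nac h
      · exact nax h
    · rintro (h | ⟨h, -⟩ | ⟨h, -⟩)
      · exact nac h
      · exact nac h
      · exact nax h

/-- Opening `cx`: `I_b = (a↮b) ∩ (b↮c)` becomes `I_b ∩ (b ↮ x)`. [this work] -/
theorem setOf_insert_mem_isoB (a b c x : V) :
    {ω : BondConfig V | insert s(c, x) ω ∈ ((openConn a b)ᶜ ∩ (openConn b c)ᶜ : Set (BondConfig V))} =
      (openConn a b)ᶜ ∩ (openConn b c)ᶜ ∩ (openConn b x)ᶜ := by
  ext ω
  have hab := KNSep.reachable_insert_iff ω c x a b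
  have hbc := KNSep.reachable_insert_iff ω c x b c
  have hcc : (openGraph ω).Reachable c c := SimpleGraph.Reachable.refl c
  simp only [mem_setOf_eq, mem_inter_iff, mem_compl_iff, openConn, hab, hbc]
  constructor
  · rintro ⟨h1, h2⟩
    exact ⟨⟨fun h => h1 (Or.inl h), fun h => h2 (Or.inl h)⟩, fun h => h2 (Or.inr (Or.inr ⟨h, hcc⟩))⟩
  · rintro ⟨⟨nab, nbc⟩, nbx⟩
    refine ⟨?_, ?_⟩
    · rintro (h | ⟨-, h⟩ | ⟨-, h⟩)
      · exact nab h
      · exact nbx h.symm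
      · exact nbc h.symm
    · rintro (h | ⟨h, -⟩ | ⟨h, -⟩)
      · exact nbc h
      · exact nbc h
      · exact nbx h

/-- Opening `cx`: `I_c = (a↮c) ∩ (b↮c)` becomes `I_c ∩ (a ↮ x) ∩ (b ↮ x)`. [this work] -/
theorem setOf_insert_mem_isoC (a b c x : V) :
    {ω : BondConfig V | insert s(c, x) ω ∈ ((openConn a c)ᶜ ∩ (openConn b c)ᶜ : Set (BondConfig V))} =
      (openConn a c)ᶜ ∩ (openConn b c)ᶜ ∩ (openConn a x)ᶜ ∩ (openConn b x)ᶜ := by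
  ext ω
  have hac := KNSep.reachable_insert_iff ω c x a c
  have hbc := KNSep.reachable_insert_iff ω c x b c
  have hcc : (openGraph ω).Reachable c c := SimpleGraph.Reachable.refl c
  simp only [mem_setOf_eq, mem_inter_iff, mem_compl_iff, openConn, hac, hbc]
  constructor
  · rintro ⟨h1, h2⟩
    exact ⟨⟨⟨fun h => h1 (Or.inl h), fun h => h2 (Or.inl h)⟩, fun h => h1 (Or.inr (Or.inr ⟨h, hcc⟩))⟩,
      fun h => h2 (Or.inr (Or.inr ⟨h, hcc⟩))⟩
  · rintro ⟨⟨⟨nac, nbc⟩, nax⟩, nbx⟩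
    refine ⟨?_, ?_⟩
    · rintro (h | ⟨h, -⟩ | ⟨h, -⟩)
      · exact nac h
      · exact nac h
      · exact nax h
    · rintro (h | ⟨h, -⟩ | ⟨h, -⟩)
      · exact nbc h
      · exact nbc h
      · exact nbx h

/-- On `a|b|c` the events `a ↔ x`, `b ↔ x` are disjoint: `a|b|c ∩ (a↮x) ∩ (b↔x) = a|b|c ∩ (b↔x)`. [this work] -/
theorem sep_inter_compl_inter_eq (a b c x : V) :
    ((openConn a b)ᶜ ∩ (openConn a c)ᶜ ∩ (openConn b c)ᶜ ∩ (openConn a x)ᶜ ∩ openConn b x : Set (BondConfig V)) =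
      (openConn a b)ᶜ ∩ (openConn a c)ᶜ ∩ (openConn b c)ᶜ ∩ openConn b x := by
  ext ω
  simp only [mem_inter_iff, mem_compl_iff, openConn, mem_setOf_eq]
  constructor
  · rintro ⟨⟨h, -⟩, hbx⟩; exact ⟨h, hbx⟩
  · rintro ⟨⟨⟨hab, hac⟩, hbc⟩, hbx⟩
    exact ⟨⟨⟨⟨hab, hac⟩, hbc⟩, fun hax => hab (hax.trans hbx.symm)⟩, hbx⟩

variable [DecidableEq V]

/-- `{a ↮ y ∀ y ∈ {a,b,c} ∖ {a}} = (a↮b) ∩ (a↮c)` for distinct `a, b, c`. [this work] -/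
theorem setOf_alone_eq_isoA {a b c : V} (hab : a ≠ b) (hac : a ≠ c) :
    {ω : BondConfig V | ∀ y ∈ (↑({a, b, c} : Finset V) : Set V) \ {a}, ¬ (openGraph ω).Reachable a y} =
      (openConn a b)ᶜ ∩ (openConn a c)ᶜ := by
  ext ω
  simp only [mem_setOf_eq, mem_inter_iff, mem_compl_iff, openConn, Finset.coe_insert, Finset.coe_singleton, mem_sdiff,
    mem_insert_iff, mem_singleton_iff]
  constructor
  · intro h
    exact ⟨h b ⟨Or.inr (Or.inl rfl), hab.symm⟩, h c ⟨Or.inr (Or.inr rfl), hac.symm⟩⟩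
  · rintro ⟨hb, hc⟩ y ⟨hy, hya⟩
    rcases hy with rfl | rfl | rfl
    · exact (hya rfl).elim
    · exact hb
    · exact hc

/-- `{b ↮ y ∀ y ∈ {a,b,c} ∖ {b}} = (a↮b) ∩ (b↮c)` for distinct `a, b, c`. [this work] -/
theorem setOf_alone_eq_isoB {a b c : V} (hab : a ≠ b) (hbc : b ≠ c) :
    {ω : BondConfig V | ∀ y ∈ (↑({a, b, c} : Finset V) : Set V) \ {b}, ¬ (openGraph ω).Reachable b y} =
      (openConn a b)ᶜ ∩ (openConn b c)ᶜ := by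
  ext ω
  simp only [mem_setOf_eq, mem_inter_iff, mem_compl_iff, openConn, Finset.coe_insert, Finset.coe_singleton, mem_sdiff,
    mem_insert_iff, mem_singleton_iff]
  constructor
  · intro h
    exact ⟨fun h' => h a ⟨Or.inl rfl, hab⟩ h'.symm, h c ⟨Or.inr (Or.inr rfl), hbc.symm⟩⟩
  · rintro ⟨hb, hc⟩ y ⟨hy, hyb⟩
    rcases hy with rfl | rfl | rfl
    · exact fun h' => hb h'.symm
    · exact (hyb rfl).elim
    · exact hc

/-- `{a, b, c pairwise separated} = (a↮b) ∩ (a↮c) ∩ (b↮c)` for distinct `a, b, c`. [this work] -/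
theorem setOf_pairwiseSep_eq {a b c : V} (hab : a ≠ b) (hac : a ≠ c) (hbc : b ≠ c) :
    {ω : BondConfig V | ∀ y ∈ ({a, b, c} : Finset V), ∀ z ∈ ({a, b, c} : Finset V), y ≠ z → ¬ (openGraph ω).Reachable y z} =
      (openConn a b)ᶜ ∩ (openConn a c)ᶜ ∩ (openConn b c)ᶜ := by
  ext ω
  simp only [mem_setOf_eq, mem_inter_iff, mem_compl_iff, openConn, Finset.mem_insert, Finset.mem_singleton]
  constructor
  · intro h
    exact ⟨⟨h a (Or.inl rfl) b (Or.inr (Or.inl rfl)) hab, h a (Or.inl rfl) c (Or.inr (Or.inr rfl)) hac⟩,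
      h b (Or.inr (Or.inl rfl)) c (Or.inr (Or.inr rfl)) hbc⟩
  · rintro ⟨⟨hab', hac'⟩, hbc'⟩ y hy z hz hyz
    rcases hy with rfl | rfl | rfl <;> rcases hz with rfl | rfl | rfl
    · exact (hyz rfl).elim
    · exact hab'
    · exact hac'
    · exact fun h' => hab' h'.symm
    · exact (hyz rfl).elim
    · exact hbc'
    · exact fun h' => hac' h'.symm
    · exact fun h' => hbc' h'.symm
    · exact (hyz rfl).elim

end Events


end Summit.CriticalPhenomena.PercolationContinuityZ3.Theorems.ThreePointIsoSexticOneBond
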